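import Literature.Topology.FourManifolds.ConnectedSumExtendedInclusions
import Literature.Geometry.Manifold.SmoothEmbeddingInverse
import HarnessLib

/-!
# The inclusion package of a Kervaire–Milnor connected sum

General differential topology (topic `Literature/Topology/FourManifolds`; everything PROVED, no
definitions).  For a connected-sum datum `D` of `M` and `N` we package, as one existential, the
two extended inclusions `jM : M → M # N`, `jN : N → M # N` (`ConnectedSumExtendedInclusions.lean`)
together with SMOOTH LEFT INVERSES on their images (`invFun` of the open smooth embeddings
`inl`, `inr`, `SmoothEmbeddingInverse.lean`) and all the relations used when maps into `M # N`
are assembled from maps into the summands (the tube of `Σ̄₂ ⊂ T⁴ # ℂℙ²` of Akhmedov–Park,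
Invent. Math. 181 (2010), §3): smoothness and injectivity off the centres, open images, the
gluing identity `jM x = jN (Φ x)` on the annulus, the meeting criterion
`jM x = jN y ↔ x ∈ Φ.source ∧ Φ x = y`, and the covering of `M # N` by the two images.

## References

* M. Kervaire, J. Milnor, *Groups of homotopy spheres I*, Ann. of Math. 77 (1963), §2. [KervaireMilnor1963]
* J. M. Lee, *Introduction to Smooth Manifolds*, 2nd ed. (2013), Prop. 4.22, Prop. 5.2. [LeeSmoothManifolds2013]
-/

noncomputable section

open scoped Manifold ContDiff Topology
open Set Function

namespace Literature.Topology.FourManifolds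

namespace ConnectedSumData

universe u v

variable {n : ℕ} {M : Type u} {N : Type v} [TopologicalSpace M] [T2Space M]
  [ChartedSpace (EuclideanSpace ℝ (Fin n)) M] [IsManifold (𝓡 n) ∞ M]
  [TopologicalSpace N] [T2Space N] [ChartedSpace (EuclideanSpace ℝ (Fin n)) N] [IsManifold (𝓡 n) ∞ N]

/-- **The inclusion package of `M # N`.** [cite: KervaireMilnor1963, §2] [cite: LeeSmoothManifolds2013, Prop. 4.22] -/
theorem exists_inclusion_package (D : ConnectedSumData n M N) (hn : n ≠ 0) :
    ∃ (jM : M → D.Glued hn) (jN : N → D.Glued hn) (jMinv : D.Glued hn → M) (jNinv : D.Glued hn → N),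
      (∀ (x : M) (hx : x ∈ (D.A : Set M)), jM x = (D.glueData hn).inl ⟨x, hx⟩) ∧
      (∀ (y : N) (hy : y ∈ (D.B : Set N)), jN y = (D.glueData hn).inr ⟨y, hy⟩) ∧
      (ContMDiffOn (𝓡 n) (𝓡 n) ∞ jM (D.A : Set M) ∧ InjOn jM (D.A : Set M) ∧
        (∀ O : Set M, IsOpen O → O ⊆ (D.A : Set M) → IsOpen (jM '' O)) ∧
        ContMDiffOn (𝓡 n) (𝓡 n) ∞ jMinv (jM '' (D.A : Set M)) ∧
        (∀ x ∈ (D.A : Set M), jMinv (jM x) = x)) ∧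
      (ContMDiffOn (𝓡 n) (𝓡 n) ∞ jN (D.B : Set N) ∧ InjOn jN (D.B : Set N) ∧
        (∀ O : Set N, IsOpen O → O ⊆ (D.B : Set N) → IsOpen (jN '' O)) ∧
        ContMDiffOn (𝓡 n) (𝓡 n) ∞ jNinv (jN '' (D.B : Set N)) ∧
        (∀ y ∈ (D.B : Set N), jNinv (jN y) = y)) ∧
      (∀ x ∈ (D.A : Set M), ∀ y ∈ (D.B : Set N), jM x = jN y → x ∈ D.Φ.source ∧ D.Φ x = y) ∧
      (∀ x ∈ D.Φ.source, jM x = jN (D.Φ x)) ∧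
      (∀ z : D.Glued hn, (∃ x ∈ (D.A : Set M), jM x = z) ∨ ∃ y ∈ (D.B : Set N), jN y = z) := by
  classical
  obtain ⟨a₀⟩ := D.nonempty_A hn
  obtain ⟨b₀⟩ := D.nonempty_B hn
  haveI : Nonempty D.A := ⟨a₀⟩
  haveI : Nonempty D.B := ⟨b₀⟩
  set d := D.glueData hn with hd
  let jM : M → D.Glued hn := fun x => if hx : x ∈ (D.A : Set M) then d.inl ⟨x, hx⟩ else d.inl a₀
  let jN : N → D.Glued hn := fun y => if hy : y ∈ (D.B : Set N) then d.inr ⟨y, hy⟩ else d.inr b₀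
  have hjM : ∀ (x : M) (hx : x ∈ (D.A : Set M)), jM x = d.inl ⟨x, hx⟩ := fun x hx => dif_pos hx
  have hjN : ∀ (y : N) (hy : y ∈ (D.B : Set N)), jN y = d.inr ⟨y, hy⟩ := fun y hy => dif_pos hy
  let jMinv : D.Glued hn → M := Subtype.val ∘ invFun d.inl
  let jNinv : D.Glued hn → N := Subtype.val ∘ invFun d.inr
  -- images are ranges of `inl`, `inr`
  have himM : jM '' (D.A : Set M) = range d.inl := by
    apply Subset.antisymm
    · rintro _ ⟨x, hx, rfl⟩; exact ⟨⟨x, hx⟩, (hjM x hx).symm⟩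
    · rintro _ ⟨⟨x, hx⟩, rfl⟩; exact ⟨x, hx, hjM x hx⟩
  have himN : jN '' (D.B : Set N) = range d.inr := by
    apply Subset.antisymm
    · rintro _ ⟨y, hy, rfl⟩; exact ⟨⟨y, hy⟩, (hjN y hy).symm⟩
    · rintro _ ⟨⟨y, hy⟩, rfl⟩; exact ⟨y, hy, hjN y hy⟩
  refine ⟨jM, jN, jMinv, jNinv, hjM, hjN, ⟨?_, ?_, ?_, ?_, ?_⟩, ⟨?_, ?_, ?_, ?_, ?_⟩, ?_, ?_, ?_⟩
  · exact D.contMDiffOn_extInl hn hjM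
  · exact D.injOn_extInl hn hjM
  · exact fun O hO hOA => D.isOpen_image_extInl hn hjM hO hOA
  · rw [himM]
    exact contMDiff_subtype_val.comp_contMDiffOn
      (Literature.Geometry.Manifold.contMDiffOn_invFun_range d.isSmoothEmbedding_inl)
  · intro x hx
    show ((invFun d.inl (jM x) : D.A) : M) = x
    rw [hjM x hx, leftInverse_invFun d.inl_injective]
  · exact D.contMDiffOn_extInr hn hjN
  · exact D.injOn_extInr hn hjN
  · exact fun O hO hOB => D.isOpen_image_extInr hn hjN hO hOB
  · rw [himN]
    exact contMDiff_subtype_val.comp_contMDiffOn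
      (Literature.Geometry.Manifold.contMDiffOn_invFun_range d.isSmoothEmbedding_inr)
  · intro y hy
    show ((invFun d.inr (jN y) : D.B) : N) = y
    rw [hjN y hy, leftInverse_invFun d.inr_injective]
  · exact fun x hx y hy h => (D.extInl_eq_extInr_iff hn hjM hjN hx hy).1 h
  · intro x hx
    have hxA : x ∈ (D.A : Set M) := D.Φ_source_subset hx
    have hyB : D.Φ x ∈ (D.B : Set N) := D.Φ_target_subset (D.Φ.map_source hx)
    exact (D.extInl_eq_extInr_iff hn hjM hjN hxA hyB).2 ⟨hx, rfl⟩
  · exact D.exists_extInl_or_extInr hn hjM hjN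

end ConnectedSumData

end Literature.Topology.FourManifolds
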